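import Summits.KontsevichZagierPeriods.KontsevichZagierPeriods.Theorems.UnfoldedStokesStokesGenerationStubRungAngularCertificate
import Summits.KontsevichZagierPeriods.KontsevichZagierPeriods.Theorems.UnfoldedStokesStokesGenerationStubRungDlogProd
import Mathlib.Topology.Algebra.Polynomial

/-!
# `StokesGeneration` (stmt-KontsevichZagierPeriods-3586), line `fibrewise_stokes` — the residual S2 for closed angular loops

Crux `Summit.KontsevichZagierPeriods.KontsevichZagierPeriods.Theses.UnfoldedStokes.StokesGeneration` (kernel-checked
equivalent to the summit). Line `fibrewise_stokes` reduces it to the residual S2 = `FibrewiseStokesGenerationConjecture`: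
every bounded closed-cube representation of value `0` is, after padding and off a null `ℚ`-semialgebraic set, a finite
sum of FIBREWISE STOKES ELEMENTS `D − (G|_{xᵢ=1} − G|_{xᵢ=0})`.

This file treats the ARGUMENT half of the dimension-1 rational layer (the sector of `π` and the arctangents). For a
complex polynomial loop `P = A + iB` with real algebraic coefficients, POSITIVE REAL PART on `[0,1]` and
`B(0) = B(1) = 0` (so `P(0), P(1) ∈ ℝ_{>0}` and the total change of `arg P` along `[0,1]` vanishes), the angular
derivative `γ·Im(P'/P) = γ (A B' − A' B)/(A² + B²)` satisfies the conclusion of S2 with `M' = 2`, no kink set, no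
null set: it is the sum of TWO fibrewise Stokes elements on `[0,1]²` with rational primitives
`G₀ = γ A B/(A² + B² x₁²)` (direction `0`; the half-angle kernel `T/(1 + T² x₁²)`, `T = B/A`, whose `x₁`-integral is
`arctan T`) and `G₁ = γ x₁ (A B' − A' B)(1/(A² + B²) − 1/(A² + B² x₁²))` (direction `1`), all four boundary terms
vanishing (`stub_rungAngularCertificate`, p125742). Machin-type identities are instances: for
`π/4 = 4 arctan(1/5) − arctan(1/239)` take `P(z) = (5 + iz)⁴ (239 − iz)(1 − iz)`, whose endpoint value
`P(1) = (476 + 480i)(238 − 240i)` is real and positive and whose argument `4 arctan(z/5) − arctan(z/239) − arctan z`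
stays in `(−π/2, π/2)`.

The companion number-theoretic reduction for values `r + Σ Cᵢ log εᵢ + Σ D_k θ_k` (Baker's theorem for real
logarithms AND angles, decomposition form) is landed separately as `stub_rungMixedBaker` (p126025); loops that leave
the right half-plane need the continuous `k`-th root of `P` (a piecewise-semialgebraic branch; kinks are allowed by
S2's `K`) and are not treated here.

References: M. Kontsevich, D. Zagier, *Periods* (2001), §1.1–1.2 (accessible identities; `π` as a period);
J. Ayoub, Ann. of Math. 181 (2015), Conj. 1.1, Rem. 1.5; J. Fresán, *Une introduction aux périodes* (2024), Rem. 3.7.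
-/

noncomputable section

set_option linter.dupNamespace false

namespace Summit.KontsevichZagierPeriods.KontsevichZagierPeriods.Cruxes.StokesGeneration.FibrewiseStokes

open MeasureTheory Set
open Literature.NumberTheory.Transcendental
open Literature.NumberTheory.Transcendental.KZ
open Literature.ModelTheory.ExponentialFields (IsSemialgebraic)

/-- **S2 for a closed angular loop with positive real part (rung 3, assembled; lead c2).** For a complex polynomial
`P = A + iB` with real algebraic coefficients, `A > 0` on `[0,1]` and `B(0) = B(1) = 0`, and `γ` real algebraic, a
closed-interval representation with integrand `γ·Im(P'/P) = γ (A B' − A' B)/(A² + B²)` (its value `γ·[arg P]₀¹ = 0`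
automatically) satisfies the conclusion of `FibrewiseStokesGeneration` with `M' = 2` — the accessible identities of the
`arctan`/`π` sector whose loop stays in the right half-plane (Machin-type formulas) lie in the line's generator
economy. [cite: KontsevichZagier2001, §1.2] -/
theorem fibrewiseStokesGeneration_angularLoop :
    ∀ (γ : ℝ) (A B : Polynomial ℝ), IsAlgebraic ℚ γ → (∀ n, IsAlgebraic ℚ (A.coeff n)) →
      (∀ n, IsAlgebraic ℚ (B.coeff n)) → (∀ u ∈ Set.Icc (0:ℝ) 1, 0 < A.eval u) →
      B.eval 0 = 0 → B.eval 1 = 0 →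
      ∀ (t : IntegralRep 1), t.domain = Set.pi Set.univ (fun _ : Fin 1 => Set.Icc (0:ℝ) 1) →
      (∀ z ∈ Set.pi Set.univ (fun _ : Fin 1 => Set.Icc (0:ℝ) 1), t.integrand z =
        γ * ((A.eval (z 0) * (Polynomial.derivative B).eval (z 0) -
          (Polynomial.derivative A).eval (z 0) * B.eval (z 0)) / (A.eval (z 0) ^ 2 + B.eval (z 0) ^ 2))) →
    ∃ (M' : ℕ) (hMM' : 1 ≤ M') (J : ℕ) (i : Fin J → Fin M') (G D : Fin J → (Fin M' → ℝ) → ℝ)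
      (K : Fin J → Set (Fin M' → ℝ)) (q : Fin J → IntegralRep M') (Z : Set (Fin M' → ℝ)),
      (∀ j, IsSemialgebraicFunOn ℚ (Set.pi Set.univ (fun _ : Fin M' => Set.Icc (0:ℝ) 1)) (G j) ∧
        IsSemialgebraicFunOn ℚ (Set.pi Set.univ (fun _ : Fin M' => Set.Icc (0:ℝ) 1)) (D j) ∧
        IsSemialgebraic ℚ (K j) ∧
        (∃ B : ℝ, ∀ x ∈ Set.pi Set.univ (fun _ : Fin M' => Set.Icc (0:ℝ) 1), |(G j) x| ≤ B) ∧
        (∀ x ∈ Set.pi Set.univ (fun _ : Fin M' => Set.Icc (0:ℝ) 1), Set.Finite {s : ℝ | Function.update x (i j) s ∈ (K j)}) ∧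
        (∀ x ∈ Set.pi Set.univ (fun _ : Fin M' => Set.Icc (0:ℝ) 1), ContinuousOn (fun s : ℝ => (G j) (Function.update x (i j) s)) (Set.Icc (0:ℝ) 1)) ∧
        (∀ x ∈ Set.pi Set.univ (fun _ : Fin M' => Set.Icc (0:ℝ) 1), x ∉ (K j) → x (i j) ∈ Set.Ioo (0:ℝ) 1 →
          HasDerivAt (fun s : ℝ => (G j) (Function.update x (i j) s)) ((D j) x) (x (i j)))) ∧
      (∀ j, (q j).domain = Set.pi Set.univ (fun _ : Fin M' => Set.Icc (0:ℝ) 1) ∧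
        ∀ x ∈ Set.pi Set.univ (fun _ : Fin M' => Set.Icc (0:ℝ) 1), (q j).integrand x =
          D j x - (G j (Function.update x (i j) 1) - G j (Function.update x (i j) 0))) ∧
      IsSemialgebraic ℚ Z ∧ volume Z = 0 ∧
      ∀ x ∈ Set.pi Set.univ (fun _ : Fin M' => Set.Icc (0:ℝ) 1), x ∉ Z →
        t.integrand (fun l => x (Fin.castLE hMM' l)) = ∑ j, (q j).integrand x := by
  intro γ A B hγ hA hB hApos hB0 hB1 t ht hti
  classical
  have hS : IsSemialgebraic ℚ (Set.pi Set.univ (fun _ : Fin 2 => Set.Icc (0:ℝ) 1)) := by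
    rw [← cube_eq_pi]; exact isSemialgebraic_cube
  have hA' : ∀ n, IsAlgebraic ℚ ((Polynomial.derivative A).coeff n) := fun n => by
    rw [Polynomial.coeff_derivative]
    exact mem_algebraicClosure_iff.mp (mul_mem (mem_algebraicClosure_iff.mpr (hA (n + 1)))
      (add_mem (natCast_mem _ n) (one_mem _)))
  have hB' : ∀ n, IsAlgebraic ℚ ((Polynomial.derivative B).coeff n) := fun n => by
    rw [Polynomial.coeff_derivative]
    exact mem_algebraicClosure_iff.mp (mul_mem (mem_algebraicClosure_iff.mpr (hB (n + 1)))
      (add_mem (natCast_mem _ n) (one_mem _)))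
  obtain ⟨G, D, r, hGD, hr, hid⟩ := stub_rungAngularCertificate γ (fun u => A.eval u) (fun u => B.eval u)
    (fun u => (Polynomial.derivative A).eval u) (fun u => (Polynomial.derivative B).eval u) hγ
    (isSemialgebraicFunOn_eval_apply hS hA 0) (isSemialgebraicFunOn_eval_apply hS hB 0)
    (isSemialgebraicFunOn_eval_apply hS hA' 0) (isSemialgebraicFunOn_eval_apply hS hB' 0)
    hApos hB0 hB1 A.continuousOn B.continuousOn (Polynomial.derivative A).continuousOn
    (Polynomial.derivative B).continuousOn (fun u _ => A.hasDerivAt u) (fun u _ => B.hasDerivAt u)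
  refine ⟨2, by norm_num, 2, fun j => j, G, D, fun _ => ∅, r, ∅, fun j => ?_, hr,
    Literature.ModelTheory.ExponentialFields.isSemialgebraic_empty, measure_empty, ?_⟩
  · obtain ⟨h1, h2, h3, h4, h5⟩ := hGD j
    exact ⟨h1, h2, Literature.ModelTheory.ExponentialFields.isSemialgebraic_empty, h3,
      fun x _ => by simp, h4, fun x hx _ hxj => h5 x hx hxj⟩
  · intro x hx _
    have hx1 : (fun l : Fin 1 => x (Fin.castLE (by norm_num : 1 ≤ 2) l)) ∈
        Set.pi Set.univ (fun _ : Fin 1 => Set.Icc (0:ℝ) 1) := fun l _ => hx _ (Set.mem_univ _)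
    rw [hti _ hx1]
    exact hid x hx

end Summit.KontsevichZagierPeriods.KontsevichZagierPeriods.Cruxes.StokesGeneration.FibrewiseStokes

end
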